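import Literature.Probability.RandomPlanarGeometry.HexSAWSurfaceWallRenewal
import HarnessLib

/-!
# An explicit bound on the mean block length `m(y)` of adsorbed wall bridges by Jensen's inequality off the
# first atom (Bednorz's `α ≤ α₀`), and the resulting explicit constants for `y ≳ 25`

Topic `Literature/Probability/RandomPlanarGeometry` (lane «pcv-sawmu», a-idea-1 g28, car «RENEWAL-MEAN»; parent
`HexSAWSurfaceWallRenewal.lean` («ADSORBED-RENEWAL»): the renewal pair of the adsorbed phase — block law
`f_s(y) = pwbLaw y s = Λ_{2s}(y) β(y)^{-2s}`, amplitudes `u_s = pwbAmp y s = P_{2s}(y) β(y)^{-2s}`, mean block length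
`m(y) = pwbMean y = Σ s f_s(y)`; for `y > μ⁴ = 6 + 4√2`: `Σ f_s = 1` (`hasSum_pwbLaw`), the geometric envelope
`f_s ≤ μ²√y θ^s`, `θ = μ²/√y` (`pwbLaw_le_geom`), the two-sided bound `(2 − m(y)) β^{2s} ≤ P_{2s}(y) ≤ β^{2s}` for ALL `s`
(`PWB_two_sided`) and the mean bound `m(y) ≤ 1 + μ⁴ θ/(1−θ)²` (`pwbMean_le`)).

THE POINT.  The parent's mean bound is summed from the envelope alone and is useless at moderate fugacity: it gives
`m(30) ≤ 52`, `m(100) ≤ 10`, and `2 − m(y) > 0` only for `y ≳ 2200`, so the all-`s` lower bound of `PWB_two_sided` is VACUOUS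
below that.  But almost all the mass of the block law sits on the FIRST atom: `f₁(y) = Λ₂(y)/β(y)² ≥ y/β(y)²`
(`div_sq_wallRate_le_pwbLaw_one`), and the half-plane window `β(y)² ≤ y + 6/y` (`y ≥ 25`, tree
`HexSAWSurfaceWallPotential.wallRate_sq_le_add_six_div`) makes `f₁(y) ≥ 0.99` there.  Jensen's inequality for the convex
`x ↦ Rˣ` applied to the law CONDITIONED OFF the atom at `1` — the one-line estimate of Bednorz behind his `α ≤ α₀`,

> "Using the inequality `R^α = R^{Σ_{n=1}^∞ (n−1)b_n/(1−b)} ≤ Σ_{n=2}^∞ b_n R^{n−1}/(1−b) ≤ (b(R) − bR)/((1−b)R) ≤ (L − bR)/((1−b)R)`,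
> we obtain that `α ≤ α₀`, where `α₀ = log((L−bR)/((1−b)R))/log R`." [Bednorz2013, §2 (PDF p. 5), between Remark 2.6 and Corollary 2.7;
> there `b_n` is the increment law, `b ≤ b₁`, `b(R) = Σ b_n Rⁿ ≤ L`, `α = (c(1) − 1)/(1 − b)`, `c(1)` = the mean]

— turns the envelope into a SHARP mean bound: with `b ≤ f₁`, `b < 1`, `R > 1`, `Σ f_k R^k ≤ L`:

  **`m − 1 ≤ (1 − b) · ( log((L − bR)/(1 − b)) / log R − 1 )`**   (`RenewalMean.mean_sub_one_le`, model-free),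

proved here by the tangent line of `x ↦ Rˣ` at the conditional mean (no measure theory: `exp t ≥ 1 + t` termwise, summed with
`hasSum_le`).  LABEL: the model-free lemma is the printed one-line Jensen step (Bednorz states it for any `b ≤ b₁` in the
paragraph of §2 between Remark 2.6 and Corollary 2.7 — there `b = b₁` gives only the companion bound `α ≥ 1`; here likewise any
`0 < b ≤ f₁`, `b < 1`) — CONSOLIDATION, no extra generality in `b`; its use on the adsorbed wall-bridge law and the resulting
explicit constants are NEW-IN-WRITING (modest).  Instantiated (`pwbMean_sub_one_le`, `pwbMean_sub_one_le_of_window`) with the envelope sum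
`L(y,R) = R + μ²√y (θR)²/(1 − θR)` (`tsum_pwbLaw_mul_pow_le`; the atom contributes at most `R`) and `b = y/B` for any certified
window `β(y)² ≤ B`.  ILLUSTRATIVE ARITHMETIC (floating point, NOT certified here; `B = y + 6/y`, `R` optimised):
`m(25) ≤ 1.29` (`R = 1.41`), `m(30) ≤ 1.17` (`R = 1.53`), `m(50) ≤ 1.041` (`R = 1.93`), `m(100) ≤ 1.008` (`R = 2.66`); with the
weaker window `β(y)² ≤ y + 4/(√y − 1)` (`y ≥ 4`): `m(20) ≤ 3.02`, `m(15) ≤ 7.96`.  CONSEQUENCES (explicit-rate lens, ROUTES §26/§29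
of the lane): (i) the parent's all-`s` two-sided bound `(2 − m(y)) β(y)^{2s} ≤ P_{2s}(y) ≤ β(y)^{2s}` becomes NON-VACUOUS from
`y ≈ 25` on (constant `≥ 0.71` at `y = 25`, `≥ 0.95` at `y = 50`) instead of `y ≳ 2200`; (ii) `m(y) < 2` is exactly the regime in
which the tree's ELEMENTARY explicit geometric rate `Renewal.abs_sub_inv_tsum_le` (parent: `abs_pwbAmp_sub_inv_pwbMean_le`, data
`G(ρ) < 1`, `G(1) = m − 1`) can be fed, so the quantitative renewal theorem for `P_{2s}(y) β^{-2s} → 1/m(y)` needs Kendall's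
complex-analytic theorem [Bednorz2013, Cor. 2.5/2.7] only on the window `μ⁴ < y ≲ 25`.

All statements about `β(y)²` enter as HYPOTHESES `(hB : wallRate y ^ 2 ≤ B)` (the tree proves `B = y + 6/y` for `y ≥ 25` and
`B = y + 4/(√y − 1)` for `y ≥ 4` in `HexSAWSurfaceWallPotential.lean`, which this file does not import).
-/

noncomputable section

open Finset Filter
open _root_.Topology

namespace Literature.Probability.RandomPlanarGeometry.SAW.HexBW.Wall

/-! ### §1 Model-free: Jensen off the first atom via the tangent line of `x ↦ Rˣ` -/

namespace RenewalMean

/-- The tangent line of the convex function `x ↦ Rˣ` (`R > 0`) at `x₀` lies below it: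
`R^{x₀} (1 + (x − x₀) log R) ≤ Rˣ` (from `1 + t ≤ eᵗ`). [cite: Bednorz2013, §2, p. 5 (Jensen step `R^α ≤ Σ_{n≥2} b_n R^{n-1}/(1-b)`)] -/
theorem rpow_tangent_le {R : ℝ} (hR : 0 < R) (x₀ x : ℝ) :
    R ^ x₀ * (1 + (x - x₀) * Real.log R) ≤ R ^ x := by
  have h1 := Real.add_one_le_exp ((x - x₀) * Real.log R)
  have hx : R ^ x = R ^ x₀ * Real.exp ((x - x₀) * Real.log R) := by
    rw [Real.rpow_def_of_pos hR, Real.rpow_def_of_pos hR, ← Real.exp_add]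
    congr 1; ring
  rw [hx]
  exact mul_le_mul_of_nonneg_left (by linarith) (Real.rpow_nonneg hR.le _)

/-- **Mean bound off the first atom (Bednorz's `α ≤ α₀`, model-free).** For a probability sequence `f` on `ℕ` with `f₀ = 0`,
mean `m = Σ k f_k`, exponential moment `Σ f_k R^k = F ≤ L` at some `R > 1`, and an atom `f₁ ≥ b` with `0 < b < 1`, `bR < L`:
`m − 1 ≤ (1 − b)(log((L − bR)/(1 − b))/log R − 1)`.  (Jensen for `x ↦ Rˣ` under the law conditioned off the mass `b` at `1`,
via the tangent line at the conditional mean `x₀ = (m − b)/(1 − b)`: `R^{x₀}(1 − b) ≤ F − bR`.)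
[cite: Bednorz2013, §2, p. 5, between Remark 2.6 and Corollary 2.7 (display `R^α ≤ … ≤ (L − bR)/((1−b)R)`,
`α₀ = log((L−bR)/((1−b)R))/log R`)] -/
theorem mean_sub_one_le {f : ℕ → ℝ} (hf : ∀ k, 0 ≤ f k) (hf0 : f 0 = 0) (hsum : HasSum f 1)
    {m : ℝ} (hm : HasSum (fun k : ℕ => (k : ℝ) * f k) m) {R F : ℝ} (hR : 1 < R)
    (hF : HasSum (fun k : ℕ => f k * R ^ k) F) {b L : ℝ} (hb0 : 0 < b) (hbf : b ≤ f 1) (hb1 : b < 1)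
    (hFL : F ≤ L) (hbRL : b * R < L) :
    m - 1 ≤ (1 - b) * (Real.log ((L - b * R) / (1 - b)) / Real.log R - 1) := by
  have hR0 : 0 < R := by linarith
  set ℓ := Real.log R with hℓdef
  have hℓ : 0 < ℓ := Real.log_pos hR
  have h1b : 0 < 1 - b := sub_pos.2 hb1
  set x₀ : ℝ := (m - b) / (1 - b) with hx₀def
  have hx : x₀ * (1 - b) = m - b := by rw [hx₀def]; field_simp
  set P : ℝ := R ^ x₀ with hPdef
  have hP0 : 0 < P := Real.rpow_pos_of_pos hR0 _
  -- the three shifted sums over `k ≥ 2`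
  have hW : HasSum (fun k : ℕ => f (k + 2)) (1 - f 1) := by
    have h := (hasSum_nat_add_iff' 2).mpr hsum
    simpa [Finset.sum_range_succ, hf0] using h
  have hM : HasSum (fun k : ℕ => ((k + 2 : ℕ) : ℝ) * f (k + 2)) (m - f 1) := by
    have h := (hasSum_nat_add_iff' 2).mpr hm
    simpa [Finset.sum_range_succ, hf0] using h
  have hS : HasSum (fun k : ℕ => f (k + 2) * R ^ (k + 2)) (F - f 1 * R) := by
    have h := (hasSum_nat_add_iff' 2).mpr hF
    simpa [Finset.sum_range_succ, hf0] using h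
  -- termwise tangent inequality on `k ≥ 2`, summed
  have hterm : ∀ k : ℕ,
      P * (f (k + 2) + ℓ * (((k + 2 : ℕ) : ℝ) * f (k + 2) - x₀ * f (k + 2))) ≤ f (k + 2) * R ^ (k + 2) := by
    intro k
    have h := mul_le_mul_of_nonneg_left (rpow_tangent_le hR0 x₀ ((k + 2 : ℕ) : ℝ)) (hf (k + 2))
    rw [Real.rpow_natCast] at h
    calc P * (f (k + 2) + ℓ * (((k + 2 : ℕ) : ℝ) * f (k + 2) - x₀ * f (k + 2)))
        = f (k + 2) * (R ^ x₀ * (1 + (((k + 2 : ℕ) : ℝ) - x₀) * Real.log R)) := by rw [hPdef, hℓdef]; ring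
      _ ≤ f (k + 2) * R ^ (k + 2) := h
  have hLHS : HasSum (fun k : ℕ => P * (f (k + 2) + ℓ * (((k + 2 : ℕ) : ℝ) * f (k + 2) - x₀ * f (k + 2))))
      (P * ((1 - f 1) + ℓ * ((m - f 1) - x₀ * (1 - f 1)))) :=
    (hW.add ((hM.sub (hW.mul_left x₀)).mul_left ℓ)).mul_left P
  have e1 : P * ((1 - f 1) + ℓ * ((m - f 1) - x₀ * (1 - f 1))) ≤ F - f 1 * R := hasSum_le hterm hLHS hS
  -- the extra weight `f 1 - b` at `k = 1`
  have e2 : (f 1 - b) * (P * (1 + (1 - x₀) * ℓ)) ≤ (f 1 - b) * R := by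
    have h := rpow_tangent_le hR0 x₀ 1
    rw [Real.rpow_one] at h
    exact mul_le_mul_of_nonneg_left h (sub_nonneg.2 hbf)
  -- add up: the `ℓ`-terms cancel by the choice of `x₀`
  have iden : P * ((1 - f 1) + ℓ * ((m - f 1) - x₀ * (1 - f 1))) + (f 1 - b) * (P * (1 + (1 - x₀) * ℓ))
      = P * (1 - b) + P * ℓ * ((m - b) - x₀ * (1 - b)) := by ring
  have hzero : P * ℓ * ((m - b) - x₀ * (1 - b)) = 0 := by
    rw [show (m - b) - x₀ * (1 - b) = 0 by linarith [hx]]; ring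
  have key : P * (1 - b) ≤ L - b * R := by linarith [e1, e2, iden, hzero, hFL]
  -- logarithms
  have hQ0 : 0 < (L - b * R) / (1 - b) := div_pos (by linarith) h1b
  have hPle : P ≤ (L - b * R) / (1 - b) := by rw [le_div_iff₀ h1b]; linarith [key]
  have hlog : x₀ * ℓ ≤ Real.log ((L - b * R) / (1 - b)) := by
    have h := Real.log_le_log hP0 hPle
    rwa [hPdef, Real.log_rpow hR0] at h
  have hx₀le : x₀ ≤ Real.log ((L - b * R) / (1 - b)) / ℓ := by rw [le_div_iff₀ hℓ]; exact hlog
  have hm1 : m - 1 = (1 - b) * (x₀ - 1) := by linarith [hx]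
  rw [hm1]
  exact mul_le_mul_of_nonneg_left (by linarith [hx₀le]) h1b.le

/-- The same bound written with Bednorz's `α₀`: `m − 1 ≤ (1 − b) · log((L − bR)/((1 − b)R))/log R`.
[cite: Bednorz2013, §2, p. 5 (`α₀ = log((L−bR)/((1−b)R))/log R`)] -/
theorem mean_sub_one_le' {f : ℕ → ℝ} (hf : ∀ k, 0 ≤ f k) (hf0 : f 0 = 0) (hsum : HasSum f 1)
    {m : ℝ} (hm : HasSum (fun k : ℕ => (k : ℝ) * f k) m) {R F : ℝ} (hR : 1 < R)
    (hF : HasSum (fun k : ℕ => f k * R ^ k) F) {b L : ℝ} (hb0 : 0 < b) (hbf : b ≤ f 1) (hb1 : b < 1)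
    (hFL : F ≤ L) (hbRL : b * R < L) :
    m - 1 ≤ (1 - b) * (Real.log ((L - b * R) / ((1 - b) * R)) / Real.log R) := by
  have h := mean_sub_one_le hf hf0 hsum hm hR hF hb0 hbf hb1 hFL hbRL
  have hR0 : 0 < R := by linarith
  have hℓ : 0 < Real.log R := Real.log_pos hR
  have h1b : 0 < 1 - b := sub_pos.2 hb1
  have hQ0 : 0 < (L - b * R) / (1 - b) := div_pos (by linarith) h1b
  have hrw : Real.log ((L - b * R) / ((1 - b) * R)) = Real.log ((L - b * R) / (1 - b)) - Real.log R := by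
    rw [show (L - b * R) / ((1 - b) * R) = ((L - b * R) / (1 - b)) / R by rw [div_div], Real.log_div hQ0.ne' hR0.ne']
  rw [hrw, sub_div, div_self hℓ.ne']
  exact h

end RenewalMean

/-! ### §2 The adsorbed wall-bridge law: the atom at `1` and the exponential moment -/

variable {y : ℝ}

/-- The atom of the block law at `s = 1`: `y/β(y)² ≤ f₁(y) = Λ₂(y)/β(y)²` (the two-step surface bridge is irreducible and
visits once). [cite: BeatonBousquetMelouDeGierDuminilCopinGuttmann2014, §3.1 (arXiv v5 p. 9: walks sticking to the surface)] -/
theorem div_sq_wallRate_le_pwbLaw_one (hy : 0 < y) : y / wallRate y ^ 2 ≤ pwbLaw y 1 := by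
  have hmem : Zd.straightWalk 2 2 ∈ ipwb 2 := by
    rw [mem_ipwb]
    refine ⟨(straightWalk_mem_pwb 1).1, by norm_num, fun k hk1 hk2 h => ?_⟩
    have hk : k = 1 := by omega
    subst hk
    exact absurd h.2.1 (by norm_num)
  have hv : visits 2 (Zd.straightWalk 2 2) = 1 := (straightWalk_mem_pwb 1).2
  have h1 : y ≤ IPWB 2 y := by
    calc y = y ^ visits 2 (Zd.straightWalk 2 2) := by rw [hv, pow_one]
      _ ≤ IPWB 2 y := Finset.single_le_sum (f := fun ω => y ^ visits 2 ω) (fun ω _ => pow_nonneg hy.le _) hmem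
  show y / wallRate y ^ 2 ≤ IPWB (2 * 1) y / wallRate y ^ (2 * 1)
  rw [mul_one]
  exact div_le_div_of_nonneg_right h1 (pow_pos (wallRate_pos y) _).le

/-- `f₁(y) ≤ 1` (`f₁ ≤ u₁ ≤ 1`). [cite: Feller1968, XIII.3] -/
theorem pwbLaw_one_le_one (hy : 0 < y) : pwbLaw y 1 ≤ 1 :=
  (pwbLaw_le_pwbAmp hy.le 1).trans (pwbAmp_le_one hy 1)

/-- The envelope value of the exponential moment: `L(y,R) = R + μ²√y (θR)²/(1 − θR)`, `θ = μ²/√y` (atom `≤ R`, tail by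
`f_s ≤ μ²√y θ^s`). [cite: MadrasSlade1993, §4.2, remark before (4.2.21) (p. 94)] -/
def meanEnvL (y R : ℝ) : ℝ :=
  R + hexConnectiveConstant ^ 2 * Real.sqrt y * (hexConnectiveConstant ^ 2 / Real.sqrt y * R) ^ 2 /
    (1 - hexConnectiveConstant ^ 2 / Real.sqrt y * R)

/-- **The exponential moment is finite and explicitly bounded**: for `y ≥ 1`, `R ≥ 0` and `θR < 1`, `Σ_s f_s(y) R^s` converges
and is `≤ L(y,R) = R + μ²√y (θR)²/(1 − θR)`. [cite: MadrasSlade1993, §4.2, remark before (4.2.21) (p. 94)] [cite: Feller1968, XIII.3] -/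
theorem hasSum_pwbLaw_mul_pow_le (hy : 1 ≤ y) {R : ℝ} (hR : 0 ≤ R)
    (hθR : hexConnectiveConstant ^ 2 / Real.sqrt y * R < 1) :
    ∃ F, HasSum (fun k : ℕ => pwbLaw y k * R ^ k) F ∧ F ≤ meanEnvL y R := by
  have hy0 : 0 < y := by linarith
  have hsq0 : 0 < Real.sqrt y := Real.sqrt_pos.2 hy0
  set θ := hexConnectiveConstant ^ 2 / Real.sqrt y with hθ
  set C := hexConnectiveConstant ^ 2 * Real.sqrt y with hC
  have hμ2 : 0 < hexConnectiveConstant ^ 2 := pow_pos hexConnectiveConstant_pos 2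
  have hθ0 : 0 < θ := div_pos hμ2 hsq0
  have hC0 : 0 < C := mul_pos hμ2 hsq0
  have hq0 : 0 ≤ θ * R := mul_nonneg hθ0.le hR
  -- envelope for the shifted terms
  have henv : ∀ k : ℕ, pwbLaw y (k + 2) * R ^ (k + 2) ≤ C * (θ * R) ^ 2 * (θ * R) ^ k := by
    intro k
    calc pwbLaw y (k + 2) * R ^ (k + 2) ≤ C * θ ^ (k + 2) * R ^ (k + 2) :=
          mul_le_mul_of_nonneg_right (pwbLaw_le_geom hy (k + 2)) (pow_nonneg hR _)
      _ = C * (θ * R) ^ 2 * (θ * R) ^ k := by rw [mul_pow, mul_pow]; ring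
  have hgeo : HasSum (fun k : ℕ => C * (θ * R) ^ 2 * (θ * R) ^ k) (C * (θ * R) ^ 2 / (1 - θ * R)) := by
    rw [div_eq_mul_inv]
    exact (hasSum_geometric_of_lt_one hq0 hθR).mul_left _
  have hnn : ∀ k : ℕ, 0 ≤ pwbLaw y (k + 2) * R ^ (k + 2) := fun k => mul_nonneg (pwbLaw_nonneg hy0.le _) (pow_nonneg hR _)
  have hsum2 : Summable (fun k : ℕ => pwbLaw y (k + 2) * R ^ (k + 2)) :=
    Summable.of_nonneg_of_le hnn henv hgeo.summable
  have hsum : Summable (fun k : ℕ => pwbLaw y k * R ^ k) := (summable_nat_add_iff 2).mp hsum2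
  refine ⟨∑' k, pwbLaw y k * R ^ k, hsum.hasSum, ?_⟩
  have hsplit := (hasSum_nat_add_iff' 2).mpr hsum.hasSum
  have h2 : ∑' k : ℕ, pwbLaw y (k + 2) * R ^ (k + 2) = (∑' k, pwbLaw y k * R ^ k) - pwbLaw y 1 * R := by
    rw [hsplit.tsum_eq]; simp [Finset.sum_range_succ, pwbLaw_zero]
  have htail : ∑' k : ℕ, pwbLaw y (k + 2) * R ^ (k + 2) ≤ C * (θ * R) ^ 2 / (1 - θ * R) :=
    hasSum_le henv hsum2.hasSum hgeo
  have hatom : pwbLaw y 1 * R ≤ R := by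
    have := pwbLaw_one_le_one hy0
    nlinarith
  rw [meanEnvL, ← hC, ← hθ]
  linarith

/-! ### §3 The explicit mean bound for adsorbed wall bridges -/

/-- **Explicit mean block length of the adsorbed phase (Jensen off the atom).** For `y > μ⁴`, any `R > 1` with `θR < 1`
(`θ = μ²/√y`) and any `0 < b < 1` with `b ≤ f₁(y)`:
`m(y) − 1 ≤ (1 − b)(log((L(y,R) − bR)/(1 − b))/log R − 1)`, `L(y,R) = R + μ²√y (θR)²/(1 − θR)`.
[cite: Bednorz2013, §2, p. 5 (`α ≤ α₀ = log((L−bR)/((1−b)R))/log R`)] [cite: MadrasSlade1993, §4.2, Theorem 4.2.2(b) (pp. 91–92)] -/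
theorem pwbMean_sub_one_le (hy : hexConnectiveConstant ^ 4 < y) {R b : ℝ} (hR : 1 < R)
    (hθR : hexConnectiveConstant ^ 2 / Real.sqrt y * R < 1) (hb0 : 0 < b) (hb1 : b < 1) (hbf : b ≤ pwbLaw y 1) :
    pwbMean y - 1 ≤ (1 - b) * (Real.log ((meanEnvL y R - b * R) / (1 - b)) / Real.log R - 1) := by
  have hμ1 : 1 < hexConnectiveConstant := HV.one_lt_hexConnectiveConstant
  have hμ4 : 1 ≤ hexConnectiveConstant ^ 4 := one_le_pow₀ hμ1.le
  have hy1 : 1 ≤ y := hμ4.trans hy.le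
  have hy0 : 0 < y := by linarith
  obtain ⟨F, hF, hFL⟩ := hasSum_pwbLaw_mul_pow_le hy1 (by linarith : (0:ℝ) ≤ R) hθR
  have hm : HasSum (fun k : ℕ => (k : ℝ) * pwbLaw y k) (pwbMean y) := (summable_mul_pwbLaw hy).hasSum
  have hbRL : b * R < meanEnvL y R := by
    have hsq0 : 0 < Real.sqrt y := Real.sqrt_pos.2 hy0
    have hμ2 : 0 < hexConnectiveConstant ^ 2 := by positivity
    have hθ0 : 0 < hexConnectiveConstant ^ 2 / Real.sqrt y := div_pos hμ2 hsq0
    have htail : 0 ≤ hexConnectiveConstant ^ 2 * Real.sqrt y * (hexConnectiveConstant ^ 2 / Real.sqrt y * R) ^ 2 /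
        (1 - hexConnectiveConstant ^ 2 / Real.sqrt y * R) := by
      apply div_nonneg (by positivity); linarith
    have hbR : b * R < R := by nlinarith
    rw [meanEnvL]; linarith
  exact RenewalMean.mean_sub_one_le (pwbLaw_nonneg hy0.le) pwbLaw_zero (hasSum_pwbLaw hy) hm hR hF hb0 hbf hb1 hFL hbRL

/-- **Window form.** If `β(y)² ≤ B` is certified (tree: `B = y + 6/y` for `y ≥ 25`, `B = y + 4/(√y − 1)` for `y ≥ 4`, in
`HexSAWSurfaceWallPotential.lean`) with `y < B`, then with `b = y/B`:
`m(y) ≤ 1 + (1 − y/B)(log((L(y,R) − (y/B)R)/(1 − y/B))/log R − 1)`; e.g. (floating point, not certified here)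
`m(25) ≤ 1.29`, `m(30) ≤ 1.17`, `m(50) ≤ 1.041`, `m(100) ≤ 1.008` — versus the parent's `pwbMean_le`: `52` at `y = 30`.
[cite: Bednorz2013, §2, p. 5] [cite: BeatonBousquetMelouDeGierDuminilCopinGuttmann2014, §3.1 Proposition 5 (arXiv v5 p. 9 l. 16: μ(y) ≥ √y; p. 10 ll. 2–3: μ(y) ∼ √y)] -/
theorem pwbMean_le_of_window (hy : hexConnectiveConstant ^ 4 < y) {R B : ℝ} (hR : 1 < R)
    (hθR : hexConnectiveConstant ^ 2 / Real.sqrt y * R < 1) (hB : wallRate y ^ 2 ≤ B) (hyB : y < B) :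
    pwbMean y ≤ 1 + (1 - y / B) * (Real.log ((meanEnvL y R - y / B * R) / (1 - y / B)) / Real.log R - 1) := by
  have hμ1 : 1 < hexConnectiveConstant := HV.one_lt_hexConnectiveConstant
  have hμ4 : 1 ≤ hexConnectiveConstant ^ 4 := one_le_pow₀ hμ1.le
  have hy0 : 0 < y := by linarith [hμ4.trans hy.le]
  have hB0 : 0 < B := hy0.trans hyB
  have hβ0 : 0 < wallRate y ^ 2 := pow_pos (wallRate_pos y) 2
  have hb0 : 0 < y / B := div_pos hy0 hB0
  have hb1 : y / B < 1 := (div_lt_one hB0).2 hyB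
  have hbf : y / B ≤ pwbLaw y 1 :=
    (div_le_div_of_nonneg_left hy0.le hβ0 hB).trans (div_sq_wallRate_le_pwbLaw_one hy0)
  have h := pwbMean_sub_one_le hy hR hθR hb0 hb1 hbf
  linarith

/-- **The all-`s` two-sided bound with the explicit mean**: for `y > μ⁴`, a certified window `β(y)² ≤ B` (`y < B`) and any
admissible `R`, for EVERY `s`:
`(1 − (1 − y/B)(log((L(y,R) − (y/B)R)/(1 − y/B))/log R − 1)) · β(y)^{2s} ≤ P_{2s}(y) ≤ β(y)^{2s}` — the parent's
`PWB_two_sided` with its constant `2 − m(y)` made explicit (positive from `y ≈ 25` on).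
[cite: MadrasSlade1993, §4.2, Theorem 4.2.2(b) (pp. 91–92)] [cite: Bednorz2013, §2, p. 5] -/
theorem PWB_two_sided_of_window (hy : hexConnectiveConstant ^ 4 < y) {R B : ℝ} (hR : 1 < R)
    (hθR : hexConnectiveConstant ^ 2 / Real.sqrt y * R < 1) (hB : wallRate y ^ 2 ≤ B) (hyB : y < B) (s : ℕ) :
    (1 - (1 - y / B) * (Real.log ((meanEnvL y R - y / B * R) / (1 - y / B)) / Real.log R - 1)) * wallRate y ^ (2 * s)
      ≤ PWB (2 * s) y ∧ PWB (2 * s) y ≤ wallRate y ^ (2 * s) := by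
  obtain ⟨h1, h2⟩ := PWB_two_sided hy s
  refine ⟨le_trans ?_ h1, h2⟩
  have hm := pwbMean_le_of_window hy hR hθR hB hyB
  exact mul_le_mul_of_nonneg_right (by linarith) (pow_nonneg (wallRate_pos y).le _)

end Literature.Probability.RandomPlanarGeometry.SAW.HexBW.Wall

end
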